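import Summits.QuantumFields.YangMills.Theorems.UnitScaleTiltFluctuationComparisonRegPrGlobalSlackLegCfgDistNaturalT3Lie
import Summits.QuantumFields.YangMills.Theorems.UnitScaleTiltFluctuationComparisonRegPrGlobalSlackKernelLegBirthV4
import HarnessLib

/-!
# `UnitScaleTiltFluctuationComparisonRegPrGlobalSlackLegCfgDistNaturalRows` — THE NATURAL CONFIGURATION FAMILY `B♮` STATED ONCE, RECORD-LIGHT: (R4-low), (N)'s configuration clause and
# the exactness «`B♮` IS print's `B_k`» for ANY datum whose old-level domains are blocks and ANY minimiser family carrying the rows r1–r3, hence for every ROWS RECORD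
# `q : ∀ K, PkgCoreRows …` — the v3 core (`PkgCoreV3.toRows`), the v3 χ-package (`toCore`, ✓p621414's letters) and the v4 χ-package of the line of record v5kD (`PkgAtV4Chi.toRows`,
# `dataOfV4chi`) (crux `FluctuationComparisonRegPrIntL`, stmt-QuantumFields-20520, STUB 3⁗χ(v4) `stub_globalTwoRunSlackFamChiV4`; cell `pub/ym-inputs`, seat ym-inputs-p11 (g2);
# count-neutral helper, def-free, registry untouched)

WHY.  Seat p11 (g0) wrote the natural family `B♮` down INLINE over the v3 χ-package `p : ∀ K, PkgAtV3Chi …` (`…LegCfgDistNaturalT3`, ✓p621414: on the new level `b + 1 = k` the birth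
configuration; below it, on print's regime `|c₋ − y(Y)|₁·2B₃θ_{b₀,p₁}(K−k)·(L^{k−b})⁻² ≤ ½`, the `𝔤ᶜ`-projection of `vec((1/i) log Ū^b(U_k(triv,W))(Γ_{y(Y),c₋} ∪ c ∪ Γ_{c₊,y(Y)}))`;
`0` on the far legs) and proved its rows there.  The line of record is now v5kD, typed over the WEAKER v4 χ-package (`AlphaInputsT3AC.PkgAtV3Chi.toV4`), whose displays read the
ROWS RECORD `fun K ↦ (p K).toRows : ∀ K, PkgCoreRows …` (`canonPolymerRows`, `birthCfgAtRows`, `dataOfV4chi p π = dataOfCoreRows (toRows ∘ p) π` by `rfl`); the v3 theorems do not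
transfer.  Following the located cure of ym-ust-20520-w2 g4 (one statement over the displayed ROW, both records), this file states `B♮`'s rows ONCE:

* §1 `exists_blockSet_of_mem_canonLocRows` — below the new level the listed domains of `canonLocRows q` are single blocks (`…NaturalT3` §2 verbatim with `Core ↦ Rows`).
* §2 AT FREE LETTERS: the family `B♮[Bnew, U]` with an ARBITRARY new-level branch `Bnew` and an ARBITRARY minimiser family `U` —
  `natural_newLevel_eq` (on the new level `B♮ = Bnew`), ★ **`cfgDistOwnΦLow_natural_of_minRows`**: for ANY datum `D : AlphaDataT3 F γ` whose listed domains below the new level are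
  blocks and ANY `U` with `MinimiserRowsT3 … (a₀ K) (a₁ K) K (U K)` (the ONE record row the proof reads, through ✓`norm_B27T_avg_minimiser_le_canonLegDist_window`),
  `CfgDistOwnΦLow D B♮[Bnew,U] (canonLegDist F) b₀ p₁ (24·L·B₃)` under the window letters `hθ`; ★ **`coe_natural_eq_vecE_B27T_of_minRows`**: on an old level and on print's regime
  the projection is the identity — `B♮` IS print's loop variable (✓`trace_B27T_eq_zero`, ✓`coe_proj_vecE_eq_of_trace_eq_zero`).
* §3 THE ROWS-RECORD FAMILY `B♮ᴿ := B♮[birthCfgAtRows q, fun K ↦ (q K).UkH]` for `q : ∀ K, PkgCoreRows F 𝔠 γ hγ hγ1 K`: `naturalRows_newLevel_eq_bcfg` ((N)'s configuration clause: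
  `B♮ᴿ K (k+1) k (domSet X) W = Bcfg_X(triv, W)` on the retained domains, ✓`birthCfgAtRows_domSet`), ★ **`cfgDistOwnΦLow_naturalRows`** ((R4-low) at the rows datum
  `dataOfCoreRows q (canonPolymerRows q)`, constant `24·L·B₃`, window letters at the record's own `(q K).a₀`, `(q K).a₁`), **`coe_naturalRows_eq_vecE_B27T`**.
  INSTANCES BY `rfl` (no restatement): the v4 χ-package `p : ∀ K, PkgAtV4Chi …` is `q := fun K ↦ (p K).toRows` (datum `dataOfV4chi p (canonPolymerRows fun K ↦ (p K).toRows)`), the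
  v3 χ-package is `q := fun K ↦ (p K).toCore.toRows` (✓p621414's `cfgDistOwnΦLow_chi_natural` is that instance, landed first).
What is NOT here (needs ym-ust-20520-w2 g4's `…KernelLegResidualSplitV4` / `…KernelLegDisplayProfileLowV4`, pending at the time of writing): (N) as `NewLevelIsBirthRows`, (R4)
`CfgDistOwnΦ` at `p₁ ≥ p₀ + r₀`, the two-run row `CfgDistΦ`, the threshold form and the door `K1aLegRowsDisplayChiAtLowV4 ⇐ (R1),(R2′),(M1),(R5)` — the sequel `…NaturalRowsDoor`.

HONEST SCOPE.  A generalisation of landed bookkeeping (the proofs are ✓p621414's and ✓p622568's with the record replaced by its two displayed rows); no new estimate; (M1)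
`OldTermsAreJetsOwnRows` at `B♮ᴿ` (the record's `oldVal` ARE jets at `B♮ᴿ` — a SPECIFICATION of the (α) record's previous-scale terms, which are free data bounded only by `h44` /
`hfloor`), (R1), (R2′), (R5) stay displays of the (α)-record desk; nothing of [Balaban1985UV3] / [Balaban1985Variational] / [Balaban1985Averaging] is asserted beyond the cited tree
theorems; no summit / rung / gap claim (YM₃ on T³ is ladder rung R3, not the Clay problem).  L-floor: none (every odd `L > 1`).

References: T. Bałaban, CMP 102 (1985) 255–275 [Balaban1985UV3] ((27)–(28) p.263, p.263 L4, (33)–(34) p.264, (43)–(44) pp.266–267, (60)–(61) p.271); CMP 102 (1985) 277–309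
[Balaban1985Variational] ((2) p.278, Thm 1 (8) p.279); CMP 98 (1985) 17–51 [Balaban1985Averaging] (Prop. 2 (52)–(54) p.26); CMP 109 (1987) 249–301 [Balaban1987RG1] ((0.1) p.251).
-/

set_option autoImplicit false

noncomputable section

open scoped Matrix.Norms.L2Operator
open Literature.MathematicalPhysics.QuantumFieldTheory.Balaban1983to89
open Literature.MathematicalPhysics.QuantumFieldTheory.Balaban1983to89.T3ContinuumYM3Torus
open Literature.MathematicalPhysics.QuantumFieldTheory.Balaban1983to89.T3UnitLawDensityEML (ℰp)
open Literature.MathematicalPhysics.QuantumFieldTheory.Balaban1983to89.T3UnitScaleTilt (θBal)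
open Literature.MathematicalPhysics.QuantumFieldTheory.Balaban1983to89.T3LevelShift (fieldShift)
open Literature.MathematicalPhysics.QuantumFieldTheory.Balaban1983to89.T3AlphaInputsAC (AlphaDataT3)
open Literature.MathematicalPhysics.QuantumFieldTheory.Balaban1983to89.TreeLengthTorus (tsys)
open Literature.MathematicalPhysics.QuantumFieldTheory.Balaban1983to89.B10Eq27TorusAxialLog
open Literature.MathematicalPhysics.QuantumFieldTheory.Balaban1983to89.B7Prop1Explicit (l1)
open Literature.MathematicalPhysics.QuantumFieldTheory.Balaban1983to89.ExpMeanLog (deltaSU)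
open Literature.MathematicalPhysics.QuantumFieldTheory.Balaban1985CMP102
open Literature.MathematicalPhysics.QuantumFieldTheory.Balaban1985CMP102.Setting
open Summit.QuantumFields.Balaban3D.Carriers
open Summit.QuantumFields.Balaban3D.Proofs.Primitives
open Summit.QuantumFields.Balaban3D.Proofs.GroupModelLieC (vecE lieC)
open Summit.QuantumFields.YangMills.Theorems
open Summit.QuantumFields.YangMills.Theorems.GlobalSlackCanonicalPolymers

namespace Summit.QuantumFields.YangMills.Theorems.GlobalSlackKernelLeg

variable {F : T3Family} {𝔠 : AlphaConsts F.L (suGroupModel 2).N} {γ : ℝ} {hγ : 0 < γ} {hγ1 : γ ≤ (min 𝔠.gamma0 1) ^ 2}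

/-! ## §1 The old blocks of the canonical rows polymerisation -/

section OldBlocks

/-- **BELOW THE NEW LEVEL THE LISTED DOMAINS OF `canonLocRows` ARE SINGLE BLOCKS**: at lattice level `k ≤ K` (trivial history), a listed domain of term level `1 ≤ i < k` of the
canonical rows polymerisation is `blockSet K i y` for an old block `y` (`exists_blockSet_of_mem_canonLocCore` with `Core ↦ Rows`). [cite: Balaban1985UV3, (43) p.266] -/
theorem exists_blockSet_of_mem_canonLocRows (q : ∀ K, AlphaInputsT3AC.PkgCoreRows F 𝔠 γ hγ hγ1 K) {K k i : ℕ} (hk : k ≤ K) (hik : i < k) (hi1 : 1 ≤ i)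
    {Y : Set (Site (F.P K) 0)} (hY : Y ∈ canonLocRows q K k (Hist.triv (F.P K) k) i) : ∃ y : Site (F.P K) i, Y = blockSet K i y := by
  classical
  cases k with
  | zero => omega
  | succ k' =>
    have hk' : k' + 1 ≤ K := hk
    have hi : i ≠ k' + 1 := by omega
    have hi' : i ∈ Finset.Icc 1 k' := Finset.mem_Icc.mpr ⟨hi1, by omega⟩
    simp only [canonLocRows, if_pos hk', if_neg hi, if_pos hi', Finset.mem_image] at hY
    obtain ⟨y, -, rfl⟩ := hY
    exact ⟨y, rfl⟩

end OldBlocks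

/-! ## §2 The natural family at free letters: a free new-level branch `Bnew`, a free minimiser family `U` with the rows r1–r3 -/

section Free

variable (Bnew : (K b : ℕ) → Set (Site (F.P K) 0) → GaugeField (F.P K) (b + 1) (Matrix.specialUnitaryGroup (Fin 2) ℂ) →
    PBond (F.P K) b → ↥(lieC (suGroupModel 2)))
  (U : (K k : ℕ) → Hist (F.P K) k → GaugeField (F.P K) k (Matrix.specialUnitaryGroup (Fin 2) ℂ) →
    GaugeField (F.P K) 0 (Matrix.specialUnitaryGroup (Fin 2) ℂ))

open Classical in
/-- **ON THE NEW LEVEL `B♮[Bnew, U]` IS ITS NEW-LEVEL BRANCH**: `B♮ K (k+1) k Y W = Bnew K k Y W` (definitional). [cite: Balaban1985UV3, (27) p.263, (60)-(61) p.271] -/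
theorem natural_newLevel_eq {p₁ : ℝ} (K k : ℕ) (Y : Set (Site (F.P K) 0)) (W : GaugeField (F.P K) (k + 1) (Matrix.specialUnitaryGroup (Fin 2) ℂ)) :
    (fun K k b Y W c =>
        if h : b + 1 = k then Bnew K b Y (h ▸ W) c
        else if (l1 (rel (anchors_nonempty (F := F) K b Y).choose c.src) : ℝ) *
            (2 * (𝔠.B₃ * θBal F.L γ 𝔠.b₀ p₁ (K - k)) * (((F.L : ℝ) ^ (k - b))⁻¹) ^ 2) ≤ 1 / 2 then
          (lieC (suGroupModel 2)).orthogonalProjectionOnto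
            (vecE (suGroupModel 2).N
              (B27T (unitsField (toUField (Averaging.iter (fun i => BlockAveraging.blockAvg (P := F.P K) (j := i) ℰp) b
                (U K k (Hist.triv (F.P K) k) W)))) (anchors_nonempty (F := F) K b Y).choose c))
        else 0) K (k + 1) k Y W = Bnew K k Y W := by
  funext c
  dsimp only
  rw [dif_pos rfl]

open Classical in
/-- ★ **(R4-low) FOR THE NATURAL FAMILY AT FREE LETTERS**: for ANY datum `D : AlphaDataT3 F γ` whose listed domains below the new level (term level `1 ≤ i < k`, lattice level `k ≤ K`,
trivial history) are single blocks (`hD`), ANY new-level branch `Bnew` and ANY minimiser family `U` carrying the rows `MinimiserRowsT3 … (a₀ K) (a₁ K) K (U K)`, the natural family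
`B♮[Bnew, U]` satisfies `CfgDistOwnΦLow D B♮ (canonLegDist F) 𝔠.b₀ p₁ (24·L·B₃)` at every profile `p₁`, as soon as every window `θ_{b₀,p₁}(n)`, `n < K`, lies in r1's range
`θ ≤ a₁ K`, `B₃θ ≤ a₀ K` and inside [B7] Prop. 2's two smallness letters (`hθ`).  Proof = ✓`cfgDistOwnΦLow_chi_natural`'s, reading the record only through `hD` and `hmin`.
[cite: Balaban1985UV3, (43)-(44) pp.266-267, (27)-(28) p.263; Balaban1985Variational, Thm 1 (8) p.279; Balaban1985Averaging, Prop. 2 (54) p.26] -/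
theorem cfgDistOwnΦLow_natural_of_minRows (D : AlphaDataT3 F γ)
    (hD : ∀ (K k i : ℕ), k ≤ K → i < k → 1 ≤ i → ∀ Y ∈ D.Loc K k (D.triv K k) i, ∃ y : Site (F.P K) i, Y = blockSet K i y)
    {a₀ a₁ : ℕ → ℝ} (hmin : ∀ K, MinimiserRowsT3 F 𝔠 γ hγ hγ1 (a₀ K) (a₁ K) K (U K)) {p₁ : ℝ}
    (hθ : ∀ K n, n < K →
      θBal F.L γ 𝔠.b₀ p₁ n ≤ a₁ K ∧ 𝔠.B₃ * θBal F.L γ 𝔠.b₀ p₁ n ≤ a₀ K ∧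
      (143 * ((((3 + 4 : ℕ) : ℝ)) ^ 2 / 4) ^ 2) * (𝔠.B₃ * θBal F.L γ 𝔠.b₀ p₁ n) ≤ 1 / 3 ∧
      2 * (𝔠.B₃ * θBal F.L γ 𝔠.b₀ p₁ n) ≤ 2 * deltaSU (Fin 2) / (((3 + 4) * F.L : ℕ) : ℝ) ^ 2) :
    CfgDistOwnΦLow D
      (fun K k b Y W c =>
        if h : b + 1 = k then Bnew K b Y (h ▸ W) c
        else if (l1 (rel (anchors_nonempty (F := F) K b Y).choose c.src) : ℝ) *
            (2 * (𝔠.B₃ * θBal F.L γ 𝔠.b₀ p₁ (K - k)) * (((F.L : ℝ) ^ (k - b))⁻¹) ^ 2) ≤ 1 / 2 then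
          (lieC (suGroupModel 2)).orthogonalProjectionOnto
            (vecE (suGroupModel 2).N
              (B27T (unitsField (toUField (Averaging.iter (fun i => BlockAveraging.blockAvg (P := F.P K) (j := i) ℰp) b
                (U K k (Hist.triv (F.P K) k) W)))) (anchors_nonempty (F := F) K b Y).choose c))
        else 0)
      (canonLegDist F) 𝔠.b₀ p₁ (24 * F.L * 𝔠.B₃) := by
  intro K n hnK j hj V hV Y hY c
  have hn : n < K := by omega
  have hKn : K - (K - n) = n := by omega
  have hjne : ¬ (j + 1 = K - n) := by omega
  obtain ⟨y', rfl⟩ := hD K (K - n) (1 + j) (by omega) (by omega) (by omega) Y hY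
  set y := (anchors_nonempty (F := F) K j (blockSet K (1 + j) y')).choose with hydef
  have hy : y ∈ anchors K j (blockSet K (1 + j) y') := (anchors_nonempty (F := F) K j (blockSet K (1 + j) y')).choose_spec
  obtain ⟨h1, h2, h3, h4⟩ := hθ K n hn
  have hγ1' : γ ≤ 1 := hγ1.trans (sq_min_one_le _ 𝔠.gamma0_pos)
  have hθpos : 0 < θBal F.L γ 𝔠.b₀ p₁ n := T3MinimiserStabilityReduction.θBal_pos F.hL.2.le hγ hγ1' 𝔠.b₀_pos p₁ n
  have hrhs : 0 ≤ 24 * (F.L : ℝ) * 𝔠.B₃ * (1 + canonLegDist F K j (blockSet K (1 + j) y') c) * θBal F.L γ 𝔠.b₀ p₁ n *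
      (((F.L : ℝ) ^ (K - n - 1 - j))⁻¹) ^ 2 := by
    have := 𝔠.B₃_pos
    have := canonLegDist_nonneg F K j (blockSet K (1 + j) y') c
    positivity
  dsimp only
  rw [dif_neg hjne, hKn]
  split_ifs with hreg
  · calc _ ≤ 2 * ‖B27T (unitsField (toUField (Averaging.iter (fun i => BlockAveraging.blockAvg (P := F.P K) (j := i) ℰp) j
            (U K (K - n) (Hist.triv (F.P K) (K - n))
              (fieldShift (F.sitesPerDir_eq (m := F.m) (K := K) (j := K - n) (m' := F.m) (K' := n) (j' := 0) (by omega)) V))))) y c‖ :=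
          norm_proj_vecE_two_le _
      _ ≤ 2 * ((12 * (F.L : ℝ) * 𝔠.B₃) * (1 + canonLegDist F K j (blockSet K (1 + j) y') c) * θBal F.L γ 𝔠.b₀ p₁ n *
            (((F.L : ℝ) ^ (K - n - 1 - j))⁻¹) ^ 2) :=
          mul_le_mul_of_nonneg_left (norm_B27T_avg_minimiser_le_canonLegDist_window (hmin K) hn hθpos
            h1 h2 h3 h4 V hV (show 1 + j = j + 1 by omega) (by omega) y' hy c hreg) (by norm_num)
      _ = _ := by ring
  · rw [norm_zero]
    exact hrhs

open Classical in
/-- ★ **ON AN OLD LEVEL AND ON PRINT'S REGIME `B♮[Bnew, U]` IS PRINT'S LOOP VARIABLE** (as vectors of the Frobenius carrier), at free letters: for `n < K`, `j + 1 < K − n`, a datum `V` on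
the `θ_{b₀,p₁}(n)`-window, the rows `MinimiserRowsT3 … a₀ a₁ K (U K)` and the window letters at `(a₀, a₁)`, on print's regime the `𝔤ᶜ`-projection is the identity:
`B♮ K (K−n) j (blockSet K (1+j) y′) (V↑) c = vec((1/i) log Ū^j(U_{K−n}(triv, V↑))(Γ_{y,c₋} ∪ c ∪ Γ_{c₊,y}))` (the averaged minimiser's plaquettes are small by [B7] Prop. 2 on r1's
clause, so the (27)-logarithm is trace-free, hence in `𝔰𝔩(2,ℂ) = 𝔤ᶜ`).  Proof = ✓`coe_natural_eq_vecE_B27T`'s. [cite: Balaban1985UV3, (27)-(28) p.263, (43) p.266; Balaban1985Variational, Thm 1 (8) p.279; Balaban1985Averaging, Prop. 2 (54) p.26] -/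
theorem coe_natural_eq_vecE_B27T_of_minRows {a₀ a₁ : ℝ} {K : ℕ} (hmin : MinimiserRowsT3 F 𝔠 γ hγ hγ1 a₀ a₁ K (U K)) {p₁ : ℝ} {n : ℕ} (hn : n < K)
    (hθ : θBal F.L γ 𝔠.b₀ p₁ n ≤ a₁ ∧ 𝔠.B₃ * θBal F.L γ 𝔠.b₀ p₁ n ≤ a₀ ∧
      (143 * ((((3 + 4 : ℕ) : ℝ)) ^ 2 / 4) ^ 2) * (𝔠.B₃ * θBal F.L γ 𝔠.b₀ p₁ n) ≤ 1 / 3 ∧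
      2 * (𝔠.B₃ * θBal F.L γ 𝔠.b₀ p₁ n) ≤ 2 * deltaSU (Fin 2) / (((3 + 4) * F.L : ℕ) : ℝ) ^ 2)
    {j : ℕ} (hj : j + 1 < K - n) (y' : Site (F.P K) (1 + j)) (V : GaugeField (F.P n) 0 (Matrix.specialUnitaryGroup (Fin 2) ℂ))
    (hV : PlaqSmall (θBal F.L γ 𝔠.b₀ p₁ n) V) (c : PBond (F.P K) j)
    (hreg : (l1 (rel (anchors_nonempty (F := F) K j (blockSet K (1 + j) y')).choose c.src) : ℝ) *
        (2 * (𝔠.B₃ * θBal F.L γ 𝔠.b₀ p₁ n) * (((F.L : ℝ) ^ (K - n - j))⁻¹) ^ 2) ≤ 1 / 2) :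
    (((fun K k b Y W c =>
        if h : b + 1 = k then Bnew K b Y (h ▸ W) c
        else if (l1 (rel (anchors_nonempty (F := F) K b Y).choose c.src) : ℝ) *
            (2 * (𝔠.B₃ * θBal F.L γ 𝔠.b₀ p₁ (K - k)) * (((F.L : ℝ) ^ (k - b))⁻¹) ^ 2) ≤ 1 / 2 then
          (lieC (suGroupModel 2)).orthogonalProjectionOnto
            (vecE (suGroupModel 2).N
              (B27T (unitsField (toUField (Averaging.iter (fun i => BlockAveraging.blockAvg (P := F.P K) (j := i) ℰp) b
                (U K k (Hist.triv (F.P K) k) W)))) (anchors_nonempty (F := F) K b Y).choose c))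
        else 0) K (K - n) j (blockSet K (1 + j) y')
        (fieldShift (F.sitesPerDir_eq (m := F.m) (K := K) (j := K - n) (m' := F.m) (K' := n) (j' := 0) (by omega)) V) c :
          lieC (suGroupModel 2)) : EuclideanSpace ℂ (Fin (suGroupModel 2).N × Fin (suGroupModel 2).N)) =
      vecE (suGroupModel 2).N
        (B27T (unitsField (toUField (Averaging.iter (fun i => BlockAveraging.blockAvg (P := F.P K) (j := i) ℰp) j
          (U K (K - n) (Hist.triv (F.P K) (K - n))
            (fieldShift (F.sitesPerDir_eq (m := F.m) (K := K) (j := K - n) (m' := F.m) (K' := n) (j' := 0) (by omega)) V)))))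
          (anchors_nonempty (F := F) K j (blockSet K (1 + j) y')).choose c) := by
  haveI : NeZero (suGroupModel 2).N := inferInstanceAs (NeZero 2)
  have hKn : K - (K - n) = n := by omega
  have hjne : ¬ (j + 1 = K - n) := by omega
  obtain ⟨h1, h2, h3, h4⟩ := hθ
  have hγ1' : γ ≤ 1 := hγ1.trans (sq_min_one_le _ 𝔠.gamma0_pos)
  have hθpos : 0 < θBal F.L γ 𝔠.b₀ p₁ n := T3MinimiserStabilityReduction.θBal_pos F.hL.2.le hγ hγ1' 𝔠.b₀_pos p₁ n
  have he : 0 < 𝔠.B₃ * θBal F.L γ 𝔠.b₀ p₁ n := mul_pos 𝔠.B₃_pos hθpos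
  dsimp only
  rw [dif_neg hjne, hKn, if_pos hreg]
  refine coe_proj_vecE_eq_of_trace_eq_zero (N := 2) (trace_B27T_eq_zero _ (by positivity) ?_ _ c hreg ?_)
  · -- the averaged field's plaquettes: [B7] Prop 2 on r1's plaquette clause, in the level factor `(L^{K−n−j})⁻²`
    have hplaq := plaqSmall_minimiser_of_rows_window hmin hn hθpos h1 h2 V hV
    have h52 : PlaqSmall ((𝔠.B₃ * θBal F.L γ 𝔠.b₀ p₁ n) * ((((F.P K).L : ℝ) ^ (K - n))⁻¹) ^ 2)
        (U K (K - n) (Hist.triv (F.P K) (K - n))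
          (fieldShift (F.sitesPerDir_eq (m := F.m) (K := K) (j := K - n) (m' := F.m) (K' := n) (j' := 0) (by omega)) V)) := by
      intro q
      convert hplaq q using 2
      rw [T3RegularMinimiser.regThreshold, ← inv_pow, ← pow_mul, mul_comm 2]
      rfl
    have hlev := BlockAveragingEMLProp2.plaqSmall_iter_blockAvg_eml_level (P := F.P K) (n := Fin 2) (K - n) he h3 h4 h52 (j := j) (by omega)
    rw [show ((F.P K).L : ℝ) = F.L from rfl, pow_mul_inv_pow_eq F (show j ≤ K - n by omega)] at hlev
    exact hlev
  · calc ((2 : ℕ) : ℝ) * ((l1 (rel (anchors_nonempty (F := F) K j (blockSet K (1 + j) y')).choose c.src) : ℝ) *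
          (2 * (𝔠.B₃ * θBal F.L γ 𝔠.b₀ p₁ n) * (((F.L : ℝ) ^ (K - n - j))⁻¹) ^ 2)) ≤ 2 * (1 / 2) := by
          rw [show ((2 : ℕ) : ℝ) = 2 by norm_num]; exact mul_le_mul_of_nonneg_left hreg (by norm_num)
      _ = 1 := by norm_num
      _ < Real.pi := by have := Real.pi_gt_three; linarith

end Free

/-! ## §3 The natural family of a rows record: `B♮ᴿ := B♮[birthCfgAtRows q, fun K ↦ (q K).UkH]` -/

section Rows

variable (q : ∀ K, AlphaInputsT3AC.PkgCoreRows F 𝔠 γ hγ hγ1 K)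

open Classical in
/-- **(N)'s CONFIGURATION CLAUSE FOR `B♮ᴿ`**: on the new level the natural family of a rows record IS the birth configuration — `B♮ᴿ K (k+1) k (domSet X) W = Bcfg_X(triv, W)` for every
retained step-`k` domain `X` of `newDomsRows q` (`k + 1 ≤ K`; ✓`birthCfgAtRows_domSet`). [cite: Balaban1985UV3, (27) p.263, (60)-(61) p.271] -/
theorem naturalRows_newLevel_eq_bcfg {p₁ : ℝ} (K k : ℕ) (hk : k + 1 ≤ K)
    (X : (tsys 3 (nblkOf (SK F 𝔠 γ hγ hγ1 K) 𝔠.lane.carrier k)).Dom) (hX : X ∈ newDomsRows q K k (Hist.triv (F.P K) (k + 1)))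
    (W : GaugeField (F.P K) (k + 1) (Matrix.specialUnitaryGroup (Fin 2) ℂ)) :
    (fun K k b Y W c =>
        if h : b + 1 = k then birthCfgAtRows q K b Y (h ▸ W) c
        else if (l1 (rel (anchors_nonempty (F := F) K b Y).choose c.src) : ℝ) *
            (2 * (𝔠.B₃ * θBal F.L γ 𝔠.b₀ p₁ (K - k)) * (((F.L : ℝ) ^ (k - b))⁻¹) ^ 2) ≤ 1 / 2 then
          (lieC (suGroupModel 2)).orthogonalProjectionOnto
            (vecE (suGroupModel 2).N
              (B27T (unitsField (toUField (Averaging.iter (fun i => BlockAveraging.blockAvg (P := F.P K) (j := i) ℰp) b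
                ((q K).UkH k (Hist.triv (F.P K) k) W)))) (anchors_nonempty (F := F) K b Y).choose c))
        else 0) K (k + 1) k (domSet (F := F) 𝔠.lane.carrier.M₁ K k X) W =
      ((q K).𝔖 k).Bcfg X (Hist.triv (F.P K) (k + 1)) W := by
  rw [natural_newLevel_eq (birthCfgAtRows q) (fun K => (q K).UkH)]
  exact birthCfgAtRows_domSet q K k (by have := F.hm; omega) X hX W

open Classical in
/-- ★ **(R4-low) `CfgDistOwnΦLow` FOR `B♮ᴿ` AT THE ROWS DATUM** `dataOfCoreRows q (canonPolymerRows q)`, every profile `p₁`, constant `24·L·B₃`, under the window letters `hθ` at the record's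
own `(q K).a₀`, `(q K).a₁` (`cfgDistOwnΦLow_natural_of_minRows` at `hD := exists_blockSet_of_mem_canonLocRows q`, `hmin K := (q K).minRows`).  The v4 χ-package instance is
`q := fun K ↦ (p K).toRows` (datum `dataOfV4chi p (canonPolymerRows fun K ↦ (p K).toRows)`, by `rfl`); the v3 χ-package instance is ✓`cfgDistOwnΦLow_chi_natural`.
[cite: Balaban1985UV3, (43)-(44) pp.266-267, (27)-(28) p.263; Balaban1985Variational, Thm 1 (8) p.279; Balaban1985Averaging, Prop. 2 (54) p.26] -/
theorem cfgDistOwnΦLow_naturalRows {p₁ : ℝ}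
    (hθ : ∀ K n, n < K →
      θBal F.L γ 𝔠.b₀ p₁ n ≤ (q K).a₁ ∧ 𝔠.B₃ * θBal F.L γ 𝔠.b₀ p₁ n ≤ (q K).a₀ ∧
      (143 * ((((3 + 4 : ℕ) : ℝ)) ^ 2 / 4) ^ 2) * (𝔠.B₃ * θBal F.L γ 𝔠.b₀ p₁ n) ≤ 1 / 3 ∧
      2 * (𝔠.B₃ * θBal F.L γ 𝔠.b₀ p₁ n) ≤ 2 * deltaSU (Fin 2) / (((3 + 4) * F.L : ℕ) : ℝ) ^ 2) :
    CfgDistOwnΦLow (AlphaInputsT3AC.dataOfCoreRows q (canonPolymerRows q))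
      (fun K k b Y W c =>
        if h : b + 1 = k then birthCfgAtRows q K b Y (h ▸ W) c
        else if (l1 (rel (anchors_nonempty (F := F) K b Y).choose c.src) : ℝ) *
            (2 * (𝔠.B₃ * θBal F.L γ 𝔠.b₀ p₁ (K - k)) * (((F.L : ℝ) ^ (k - b))⁻¹) ^ 2) ≤ 1 / 2 then
          (lieC (suGroupModel 2)).orthogonalProjectionOnto
            (vecE (suGroupModel 2).N
              (B27T (unitsField (toUField (Averaging.iter (fun i => BlockAveraging.blockAvg (P := F.P K) (j := i) ℰp) b
                ((q K).UkH k (Hist.triv (F.P K) k) W)))) (anchors_nonempty (F := F) K b Y).choose c))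
        else 0)
      (canonLegDist F) 𝔠.b₀ p₁ (24 * F.L * 𝔠.B₃) :=
  cfgDistOwnΦLow_natural_of_minRows (birthCfgAtRows q) (fun K => (q K).UkH) (AlphaInputsT3AC.dataOfCoreRows q (canonPolymerRows q))
    (fun _ _ _ hk hik hi1 _ hY => exists_blockSet_of_mem_canonLocRows q hk hik hi1 hY) (fun K => (q K).minRows) hθ

open Classical in
/-- **ON AN OLD LEVEL AND ON PRINT'S REGIME `B♮ᴿ` IS PRINT'S LOOP VARIABLE** `vec((1/i) log Ū^j(U_{K−n}(triv, V↑))(Γ_{y,c₋} ∪ c ∪ Γ_{c₊,y}))` (`coe_natural_eq_vecE_B27T_of_minRows` at the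
record's `(q K).minRows` and its own `(q K).a₀`, `(q K).a₁`). [cite: Balaban1985UV3, (27)-(28) p.263, (43) p.266; Balaban1985Variational, Thm 1 (8) p.279; Balaban1985Averaging, Prop. 2 (54) p.26] -/
theorem coe_naturalRows_eq_vecE_B27T {p₁ : ℝ} {K n : ℕ} (hn : n < K)
    (hθ : θBal F.L γ 𝔠.b₀ p₁ n ≤ (q K).a₁ ∧ 𝔠.B₃ * θBal F.L γ 𝔠.b₀ p₁ n ≤ (q K).a₀ ∧
      (143 * ((((3 + 4 : ℕ) : ℝ)) ^ 2 / 4) ^ 2) * (𝔠.B₃ * θBal F.L γ 𝔠.b₀ p₁ n) ≤ 1 / 3 ∧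
      2 * (𝔠.B₃ * θBal F.L γ 𝔠.b₀ p₁ n) ≤ 2 * deltaSU (Fin 2) / (((3 + 4) * F.L : ℕ) : ℝ) ^ 2)
    {j : ℕ} (hj : j + 1 < K - n) (y' : Site (F.P K) (1 + j)) (V : GaugeField (F.P n) 0 (Matrix.specialUnitaryGroup (Fin 2) ℂ))
    (hV : PlaqSmall (θBal F.L γ 𝔠.b₀ p₁ n) V) (c : PBond (F.P K) j)
    (hreg : (l1 (rel (anchors_nonempty (F := F) K j (blockSet K (1 + j) y')).choose c.src) : ℝ) *
        (2 * (𝔠.B₃ * θBal F.L γ 𝔠.b₀ p₁ n) * (((F.L : ℝ) ^ (K - n - j))⁻¹) ^ 2) ≤ 1 / 2) :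
    (((fun K k b Y W c =>
        if h : b + 1 = k then birthCfgAtRows q K b Y (h ▸ W) c
        else if (l1 (rel (anchors_nonempty (F := F) K b Y).choose c.src) : ℝ) *
            (2 * (𝔠.B₃ * θBal F.L γ 𝔠.b₀ p₁ (K - k)) * (((F.L : ℝ) ^ (k - b))⁻¹) ^ 2) ≤ 1 / 2 then
          (lieC (suGroupModel 2)).orthogonalProjectionOnto
            (vecE (suGroupModel 2).N
              (B27T (unitsField (toUField (Averaging.iter (fun i => BlockAveraging.blockAvg (P := F.P K) (j := i) ℰp) b
                ((q K).UkH k (Hist.triv (F.P K) k) W)))) (anchors_nonempty (F := F) K b Y).choose c))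
        else 0) K (K - n) j (blockSet K (1 + j) y')
        (fieldShift (F.sitesPerDir_eq (m := F.m) (K := K) (j := K - n) (m' := F.m) (K' := n) (j' := 0) (by omega)) V) c :
          lieC (suGroupModel 2)) : EuclideanSpace ℂ (Fin (suGroupModel 2).N × Fin (suGroupModel 2).N)) =
      vecE (suGroupModel 2).N
        (B27T (unitsField (toUField (Averaging.iter (fun i => BlockAveraging.blockAvg (P := F.P K) (j := i) ℰp) j
          ((q K).UkH (K - n) (Hist.triv (F.P K) (K - n))
            (fieldShift (F.sitesPerDir_eq (m := F.m) (K := K) (j := K - n) (m' := F.m) (K' := n) (j' := 0) (by omega)) V)))))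
          (anchors_nonempty (F := F) K j (blockSet K (1 + j) y')).choose c) :=
  coe_natural_eq_vecE_B27T_of_minRows (birthCfgAtRows q) (fun K => (q K).UkH) (q K).minRows hn hθ hj y' V hV c hreg

end Rows

end Summit.QuantumFields.YangMills.Theorems.GlobalSlackKernelLeg

end
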